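import Literature.MathematicalPhysics.QuantumFieldTheory.ConformalBootstrap3D.PointKernelK34Data

/-!
# K34 certificate, kernel block file M4: (M) rows `42 ≤ j < 54` of `mrows`, in 6 row groups

`decide` by kernel reduction (no `native_decide`, no extra axioms) of the block checker of
`PointKernel` on the literal data of `PointKernelK34Data`; soundness is `PCert.mBlockOK_sound`.
Estimated kernel time 178 s (6 theorems).
-/

set_option maxRecDepth 100000
set_option maxHeartbeats 0

namespace Literature.MathematicalPhysics.QuantumFieldTheory.ConformalBootstrap3D.PointKernelK34

open Literature.MathematicalPhysics.QuantumFieldTheory.ConformalBootstrap3D.PointKernel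

/-- (M) rows `[42, 44)` pass the kernel evaluator. [folklore] -/
theorem mBlock_42 : cert.mBlockOK mrows 42 44 = true := by
  decide +kernel

/-- (M) rows `[44, 46)` pass the kernel evaluator. [folklore] -/
theorem mBlock_44 : cert.mBlockOK mrows 44 46 = true := by
  decide +kernel

/-- (M) rows `[46, 48)` pass the kernel evaluator. [folklore] -/
theorem mBlock_46 : cert.mBlockOK mrows 46 48 = true := by
  decide +kernel

/-- (M) rows `[48, 50)` pass the kernel evaluator. [folklore] -/
theorem mBlock_48 : cert.mBlockOK mrows 48 50 = true := by
  decide +kernel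

/-- (M) rows `[50, 52)` pass the kernel evaluator. [folklore] -/
theorem mBlock_50 : cert.mBlockOK mrows 50 52 = true := by
  decide +kernel

/-- (M) rows `[52, 54)` pass the kernel evaluator. [folklore] -/
theorem mBlock_52 : cert.mBlockOK mrows 52 54 = true := by
  decide +kernel

end Literature.MathematicalPhysics.QuantumFieldTheory.ConformalBootstrap3D.PointKernelK34
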